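import Summits.Parity.GeneralizedHardyLittlewood.Theorems.GreenTaoLevelTwoGITwoCyclicInverseSymmetry
import Summits.Parity.GeneralizedHardyLittlewood.Theorems.GreenTaoLevelTwoGITwoCyclicInverseSymmetryHalf
import Summits.Parity.GeneralizedHardyLittlewood.Theorems.GreenTaoLevelTwoGITwoCyclicInverseHalving

/-!
# Route `GreenTaoLevelTwo`, crux `GITwo` (stmt-Parity-21275), line `birth`, stub `stub_cyclicInverse`:
# C13 assembly, step 2: the symmetric halved frequency map (GT08a arXiv Lemma 46 ⇒ §9 Step 3 input)

Eightieth helper file toward the XL stub `stub_cyclicInverse` (B. Green, T. Tao, *An inverse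
theorem for the Gowers `U³(G)` norm*, arXiv:math/0503014, Thm. 68 = PEMS 51 (2008) Thm. 12.8).
Block C13 (§9 Step 3, first sentence: "Henceforth we assume `M` symmetric, `(symm-2)` holds on
`B(S₃,ρ₃)`"): from the (eq9.72) data (`…DerivativeInput`) arXiv Lemma 46 (`symmetry_of_derivative`)
bounds the antisymmetric form of the doubled map `μ`; for `N` odd the halved map `M = c·μ`
(`2c = 1`, `…Halving`) satisfies `2M = μ`, inherits additivity, and — by `symmetry_half` — obeys the
same bound with `x` measured against `c·S`.  Def-free packaging, with the smallness conditions on the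
second variable kept explicit:

* `exists_symmetric_halved_map` — `∃ ρ₂ ρ' F` (polynomial bounds in `κ, d`) such that for `c` with
  `2c = 1`, every `0 < t ≤ 1/8`, every `x` with `‖x(cξ)‖ ≤ t` (`ξ ∈ S`) and every `z` small w.r.t.
  `S` and `F`: `‖toAddCircle(cμ(x)z − cμ(z)x)‖ ≤ 4·2¹²·d·t/(ρ₂(κ⁴/8)²)`.

References: [GreenTao2008U3Inverse] arXiv:math/0503014, Lemma 46 and §9 Step 3.
-/

noncomputable section

namespace Summit.Parity.GeneralizedHardyLittlewood.GreenTaoLevelTwoGITwoCyclicInverse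

open Finset ZMod
open Literature.NumberTheory.Sieve

variable {N : ℕ} [NeZero N]

/-- **The symmetric halved frequency map (arXiv Lemma 46 + halving).**  Under the hypotheses of
`symmetry_of_derivative` (nonempty `S`, `0 < ρ₁ ≤ 1/8` with `B(S,ρ₁)` regular, `μ` additive on
`B(S,¼)`, `0 < κ ≤ 1`, `1`-bounded weights with the (eq9.72) bound), there are `ρ₂ ≥ κ²ρ₁/(1600d)`,
`ρ' ≥ (κ⁴/8)ρ₂/(800d)` and `F` with `#F ≤ 128/(κ⁴/8)⁴` such that for every `c` with `2c = 1`, every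
`0 < t ≤ 1/8`, every `x` with `‖x·(cξ)‖ ≤ t` for `ξ ∈ S`, and every `z` with
`‖zξ‖ < (κ⁴/8)⁸ρ'/(2³²d)` (`ξ ∈ S`), `‖zζ‖ ≤ 1/12` (`ζ ∈ F`):
`‖toAddCircle(cμ(x)·z − cμ(z)·x)‖ ≤ 4·(2¹² d t/(ρ₂ (κ⁴/8)²))`.
[cite: GreenTao2008U3Inverse, Lemma 46 and §9 Step 3] -/
theorem exists_symmetric_halved_map (S : Finset (ZMod N)) (hS : S.Nonempty) {ρ₁ κ : ℝ}
    (hρ₁ : 0 < ρ₁) (hρ₁8 : ρ₁ ≤ 1 / 8) (hκ : 0 < κ) (hκ1 : κ ≤ 1)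
    (hreg₁ : ∀ r : ℝ, |r| ≤ 1 / (100 * (#S : ℝ)) →
      (1 - 100 * (#S : ℝ) * |r|) * #{x : ZMod N | ∀ ξ ∈ S, ‖ZMod.toAddCircle (x * ξ)‖ < ρ₁} ≤
          #{x : ZMod N | ∀ ξ ∈ S, ‖ZMod.toAddCircle (x * ξ)‖ < (1 + r) * ρ₁} ∧
        (#{x : ZMod N | ∀ ξ ∈ S, ‖ZMod.toAddCircle (x * ξ)‖ < (1 + r) * ρ₁} : ℝ) ≤
          (1 + 100 * (#S : ℝ) * |r|) * #{x : ZMod N | ∀ ξ ∈ S, ‖ZMod.toAddCircle (x * ξ)‖ < ρ₁})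
    {μ : ZMod N → ZMod N}
    (hadd : ∀ h₁ h₂ : ZMod N, (∀ ξ' ∈ S, ‖ZMod.toAddCircle (h₁ * ξ')‖ ≤ 1 / 4) →
      (∀ ξ' ∈ S, ‖ZMod.toAddCircle (h₂ * ξ')‖ ≤ 1 / 4) →
      (∀ ξ' ∈ S, ‖ZMod.toAddCircle ((h₁ + h₂) * ξ')‖ ≤ 1 / 4) → μ (h₁ + h₂) = μ h₁ + μ h₂)
    (c₂ c₃ : ZMod N → ℂ) (hc₂ : ∀ x, ‖c₂ x‖ ≤ 1) (hc₃ : ∀ x, ‖c₃ x‖ ≤ 1)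
    (hbig : κ * N * #{x : ZMod N | ∀ ξ ∈ S, ‖ZMod.toAddCircle (x * ξ)‖ < ρ₁} ≤
      ∑ h ∈ ({x : ZMod N | ∀ ξ ∈ S, ‖ZMod.toAddCircle (x * ξ)‖ < ρ₁} : Finset (ZMod N)),
        ‖∑ x : ZMod N, c₂ (x + h) * c₃ x * stdAddChar (-(μ h * x))‖) :
    ∃ (ρ₂ ρ' : ℝ) (F : Finset (ZMod N)),
      κ ^ 2 * ρ₁ / (1600 * (#S : ℝ)) ≤ ρ₂ ∧ (κ ^ 4 / 8) / (800 * (#S : ℝ)) * ρ₂ ≤ ρ' ∧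
      (#F : ℝ) ≤ 128 / (κ ^ 4 / 8) ^ 4 ∧
      ∀ (c : ZMod N), 2 * c = 1 → ∀ (t : ℝ), 0 < t → t ≤ 1 / 8 →
        ∀ x : ZMod N, (∀ ξ ∈ S, ‖ZMod.toAddCircle (x * (c * ξ))‖ ≤ t) →
        ∀ z : ZMod N, (∀ ξ ∈ S, ‖ZMod.toAddCircle (z * ξ)‖ <
            (κ ^ 4 / 8) ^ 8 / (2 ^ 32 * (#S : ℝ)) * ρ') →
          (∀ ζ ∈ F, ‖ZMod.toAddCircle (z * ζ)‖ ≤ 1 / 12) →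
            ‖ZMod.toAddCircle (c * μ x * z) - ZMod.toAddCircle (c * μ z * x)‖ ≤
              4 * (2 ^ 12 * (#S : ℝ) * t / (ρ₂ * (κ ^ 4 / 8) ^ 2)) := by
  obtain ⟨ρ₂, ρ', F, hρ₂, hρ', hF, hsym⟩ :=
    symmetry_of_derivative S hS hρ₁ hρ₁8 hκ hκ1 hreg₁ hadd c₂ c₃ hc₂ hc₃ hbig
  refine ⟨ρ₂, ρ', F, hρ₂, hρ', hF, fun c hc t ht ht8 x hx z hzS hzF => ?_⟩
  refine symmetry_half S hc μ z (fun x' hx' => hsym t ht x' hx' z hzS hzF) (fun x' hx' => ?_) hx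
  -- additivity `μ(x'+x') = μ x' + μ x'` from additivity on `B(S,¼)` (`t ≤ 1/8`)
  refine hadd x' x' (fun ξ hξ => (hx' ξ hξ).trans (by linarith)) (fun ξ hξ => (hx' ξ hξ).trans (by linarith))
    (fun ξ hξ => ?_)
  rw [add_mul, map_add]
  calc ‖ZMod.toAddCircle (x' * ξ) + ZMod.toAddCircle (x' * ξ)‖
      ≤ ‖ZMod.toAddCircle (x' * ξ)‖ + ‖ZMod.toAddCircle (x' * ξ)‖ := norm_add_le _ _
    _ ≤ t + t := add_le_add (hx' ξ hξ) (hx' ξ hξ)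
    _ ≤ 1 / 4 := by linarith

end Summit.Parity.GeneralizedHardyLittlewood.GreenTaoLevelTwoGITwoCyclicInverse
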